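import Summits.ABC.StewartYu.ArchG3Functions
import Summits.ABC.StewartYu.FeldmanDirectionalWeights
import Summits.ABC.StewartYu.MonomialDenominators
import HarnessLib

/-!
# Cell abc-stewartyu, rung A1.L (crux r2 `ArchCoreRat`), parcel WP-L.A P-A4: the VALUES of the archimedean Gen-3 family — Fel'dman's
# directional Δ-weights carried by the integer coefficients, the change of basis (mixed values vanish when the Δ-values do), and the
# clearing denominators of the rational values (Liouville data)

`Summits/ABC/StewartYu/ArchG3Values.lean` — sequel to `ArchG3Functions` (cell `abc-stewartyu`, seat p5-g7; tranche plan §4′ P-A4; DESIGN FINDING #2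
of HOME/STATUS 2026-08-27).  Definitions (`yΔ`, `pvΔ`) and theorems on `ArchG3Setup`; no named fact.  Place-free algebra over `ℚ`, reusing
the tree's `DirWeights` (Fel'dman–Nesterenko binomial weights `Δ_μ(y) = y(y+1)⋯(y+μ−1)/μ! = multichoose(y, μ) ∈ ℤ`, change of basis) and
`MonomialDen` (one clearing denominator for all monomials `∏ αⱼ^{eⱼ}` in a box).

THE POINT (archimedean only).  Over `ℂ` the directional MONOMIALS `∏ (𝔛ₖ/b_{j₀})^{σₖ}` of `zγpow` (harmless `p`-adically) would cost
`Γ^{|σ|}` with `|σ|` up to `≈ (2n+2)L`, i.e. `≈ L·log L ∋ L·log Ω` — not affordable against `L·log(eB)` (`ArchCoreRat` has no `log A` term);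
print (Nesterenko 2003 (3.28), (3.34), (4.17)) extrapolates the function whose directional factor is the INTEGER `∏ₖ Δ_{μₖ}(c(𝔛ₖ(λ) − eₖ))` of
size `(Σ|y|+|μ|)^{|μ|}/|μ|!` (Fel'dman).  Here the Δ-weights go into the integer COEFFICIENTS `pvΔ pv c e μ i = pv i · ∏ₖ multichoose(c·(𝔛ₖ(vᵢ)
− eₖ), μₖ)`, so that `archF R v B (pvΔ μ) (a, 0)` IS print's `f` for the multi-index `(a; μ)` (normalised growth via `ArchG3Sizes` with
`∏Γ^0 = 1`), and the index `τ = (t₀, σ)` of `archF` is only the bookkeeping of `d/dz` (the MIXED values `archφ (pvΔ μ) (a′, σ) x` are print's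
`Λ(t̄)` of (4.20)).  This file proves:

* `pvΔ_zero`, `pvΔ_cast` (`= pv i · ∏ₖ Δ_{μₖ}(c(𝔛ₖ(vᵢ) − eₖ))` in `ℚ`), **`abs_pvΔ_le`** (the normalised size);
* **`archφ_pvΔ_eq_zero_of_delta_vanishing`** — print (4.21): if the Δ-values `archφ (pvΔ μ′) (a, 0) x` vanish for `|μ′| ≤ U` (`c ≠ 0`) then
  the mixed values `archφ (pvΔ μ) (a, σ) x` vanish for `|μ| + |σ| ≤ U` (via `DirWeights`); `archφ_pvΔ_eq_zero_of_invariant`;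
* **`exists_int_clear_mul_archφ_zero`** — for ANY integer coefficients `pv′` (e.g. `pvΔ μ`) and exponents in the box `|vᵢⱼ| ≤ Dboxⱼ`:
  `den₀ · monDen(α, Dbox·|x|) · archφ pv′ (a, 0) x ∈ ℤ` when `den₀` clears the `Y₀`-weights (NO power of `b_{j₀}`); `exists_int_clear_mul_archφ`
  (general `σ`, extra factor `|b_{j₀}|^{|σ|}`); `one_le_clear`, `log_clear_le`; the START's matrix `qTermΔ`, `archφ_pvΔ_zero_eq_sum`,
  `exists_int_clear_mul_qTermΔ`, `abs_clear_mul_qTermΔ_le`.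

WHAT THIS IS NOT: no Siegel step (the unknowns/equations layer is the START's, p1), no Liouville conclusion (lp-1's `ArchKStep.rat_eq_zero_of_abs_lt`
consumes `exists_int_clear_mul_archφ_zero`), no parameters; no crux moves.

References: Yu. V. Nesterenko, LNM 1819 (2003), §3.5 (3.28)–(3.30), (3.34), (3.37), §4 (4.6)–(4.7), §4.2 (4.17), (4.20)–(4.22); Lemma 3.11.
-/

noncomputable section
open Finset Polynomial
open Literature.NumberTheory.Transcendental
open Literature.NumberTheory.Transcendental.CW77.Setup (Tau tauNorm)
open Summit.ABC.StewartYu.DirWeights (dirDelta dirDelta_eval_intCast prod_dirDelta_eval_intCast abs_prod_dirDelta_eval_le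
  dirMoment_eq_zero_of_dirDelta_sums sum_mul_prod_dirDelta_mul_pow_eq_zero)
open scoped Nat

namespace Summit.ABC.StewartYu

namespace ArchG3Setup

variable (S : ArchG3Setup) {ι : Type*} (R : ι → ℚ[X]) (v : ι → Fin S.n → ℤ)

/-! ### The Δ-weighted integer coefficients -/
/-- The recentred integer argument of the directional weight in direction `k`: `yₖ(w) = c·(𝔛ₖ(w) − eₖ)` (print: `c = 2ˢN`, `eₖ = 𝔛ₖ(wₛ)`;
design B over `ℤⁿ`: `c = 1`, `e = 0`). [cite: Nesterenko2003, §3.5 (3.34)] -/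
def yΔ (c : ℤ) (e : Fin S.n → ℤ) (w : Fin S.n → ℤ) (k : Fin S.n) : ℤ := c * (S.𝔛 w k - e k)

/-- **The Δ-weighted coefficients** `pvΔ pv c e μ i = pv i · ∏ₖ multichoose(yₖ(vᵢ), μₖ) ∈ ℤ` — Fel'dman's directional weights
`Δ_{μₖ}(yₖ) = yₖ(yₖ+1)⋯(yₖ+μₖ−1)/μₖ!` folded into the integer coefficient vector of the family. [cite: Nesterenko2003, §3.5 (3.28), (3.34)] -/
def pvΔ (pv : ι → ℤ) (c : ℤ) (e : Fin S.n → ℤ) (μ : Fin S.n → ℕ) (i : ι) : ℤ :=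
  pv i * ∏ k, Ring.multichoose (S.yΔ c e (v i) k) (μ k)

/-- `μ = 0` gives back the plain coefficients. [folklore] -/
@[simp] theorem pvΔ_zero (pv : ι → ℤ) (c : ℤ) (e : Fin S.n → ℤ) : S.pvΔ v pv c e 0 = pv := by
  funext i
  simp [pvΔ]

/-- In `ℚ`: `pvΔ μ i = pv i · ∏ₖ Δ_{μₖ}(yₖ(vᵢ))`. [cite: Nesterenko2003, §3.5 (3.34)] -/
theorem pvΔ_cast (pv : ι → ℤ) (c : ℤ) (e : Fin S.n → ℤ) (μ : Fin S.n → ℕ) (i : ι) :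
    (S.pvΔ v pv c e μ i : ℚ) = (pv i : ℚ) * ∏ k, (dirDelta ℚ (μ k)).eval ((S.yΔ c e (v i) k : ℤ) : ℚ) := by
  unfold pvΔ
  push_cast
  congr 1
  have h := prod_dirDelta_eval_intCast (K := ℚ) univ μ (fun k => S.yΔ c e (v i) k)
  rw [h]
  push_cast
  rfl

/-- The recentred argument read in `ℚ`: `yₖ = c·(𝔛ₖ − eₖ)`. [folklore] -/
theorem yΔ_cast (c : ℤ) (e : Fin S.n → ℤ) (w : Fin S.n → ℤ) (k : Fin S.n) :
    ((S.yΔ c e w k : ℤ) : ℚ) = (c : ℚ) * ((S.𝔛 w k : ℚ) - (e k : ℚ)) := by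
  unfold yΔ; push_cast; ring

/-- **The normalised size of the Δ-weighted coefficients**: `|pvΔ μ i| ≤ |pv i| · (Σₖ |yₖ(vᵢ)| + |μ|)^{|μ|} / |μ|!`.
[cite: Nesterenko2003, §3.5 (3.37), §4.2 (4.22)] -/
theorem abs_pvΔ_le (pv : ι → ℤ) (c : ℤ) (e : Fin S.n → ℤ) (μ : Fin S.n → ℕ) (i : ι) :
    |(S.pvΔ v pv c e μ i : ℝ)| ≤
      |(pv i : ℝ)| * ((∑ k, |(S.yΔ c e (v i) k : ℝ)| + (∑ k, μ k : ℕ)) ^ (∑ k, μ k) / ((∑ k, μ k)! : ℝ)) := by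
  have hcast : (S.pvΔ v pv c e μ i : ℝ) = (pv i : ℝ) * ∏ k, (dirDelta ℝ (μ k)).eval ((S.yΔ c e (v i) k : ℤ) : ℝ) := by
    unfold pvΔ
    push_cast
    congr 1
    have h := prod_dirDelta_eval_intCast (K := ℝ) univ μ (fun k => S.yΔ c e (v i) k)
    rw [h]
    push_cast
    rfl
  rw [hcast, abs_mul]
  refine mul_le_mul_of_nonneg_left ?_ (abs_nonneg _)
  have h := abs_prod_dirDelta_eval_le (K := ℝ) univ μ (fun k => ((S.yΔ c e (v i) k : ℤ) : ℝ))
  simpa using h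

/-- The box bound for the recentred arguments: `|yₖ(w)| ≤ |c|·(|b_{j₀}|Lₖ + |bₖ|L_{j₀} + |eₖ|)` when `|wⱼ| ≤ Lⱼ`.
[cite: Nesterenko2003, §3.5 (3.36)] -/
theorem abs_yΔ_le_of_box (c : ℤ) (e : Fin S.n → ℤ) {L : Fin S.n → ℕ} {w : Fin S.n → ℤ} (hw : ∀ j, |w j| ≤ (L j : ℤ))
    (k : Fin S.n) :
    |(S.yΔ c e w k : ℝ)| ≤ |(c : ℝ)| * (|(S.b S.j₀ : ℝ)| * (L k : ℝ) + |(S.b k : ℝ)| * (L S.j₀ : ℝ) + |(e k : ℝ)|) := by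
  unfold yΔ
  push_cast
  rw [abs_mul]
  refine mul_le_mul_of_nonneg_left ?_ (abs_nonneg _)
  calc |(S.𝔛 w k : ℝ) - (e k : ℝ)| ≤ |(S.𝔛 w k : ℝ)| + |(e k : ℝ)| := abs_sub _ _
    _ ≤ |(S.b S.j₀ : ℝ)| * (L k : ℝ) + |(S.b k : ℝ)| * (L S.j₀ : ℝ) + |(e k : ℝ)| :=
        add_le_add (S.abs_𝔛_real_le_of_box hw k) le_rfl

/-! ### The change of basis: mixed values vanish when the Δ-values do -/
/-- `zγpow` as a monomial over a power of `b_{j₀}`: `∏ₖ zγₖ^{σₖ} = (∏ₖ 𝔛ₖ^{σₖ}) · (b_{j₀}⁻¹)^{|σ|}`. [folklore] -/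
theorem zγpow_eq_prod_mul_inv_pow (i : ι) (σ : Fin S.n → ℕ) :
    S.zγpow v i σ = (∏ k, (S.𝔛 (v i) k : ℚ) ^ σ k) * ((S.b S.j₀ : ℚ)⁻¹) ^ (∑ k, σ k) := by
  unfold zγpow zγ
  rw [← prod_pow_eq_pow_sum, ← prod_mul_distrib]
  refine prod_congr rfl fun k _ => ?_
  rw [div_eq_mul_inv, mul_pow]

/-- **The mixed value as a Δ-sum**: with `W i = pv i · (Hasse_a Rᵢ)(x) · ∏ⱼ αⱼ^{vᵢⱼ x}` and `Xᵢₖ = 𝔛ₖ(vᵢ)`,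
`b_{j₀}^{|σ|} · archφ (pvΔ μ) (a, σ) x = Σᵢ W i · ∏ₖ Δ_{μₖ}(c(Xᵢₖ − eₖ)) · Xᵢₖ^{σₖ}`. [cite: Nesterenko2003, §4.2 (4.20) (the sums Λ(t̄))] -/
theorem bpow_mul_archφ_pvΔ (B : Finset ι) (pv : ι → ℤ) (c : ℤ) (e : Fin S.n → ℤ) (μ σ : Fin S.n → ℕ) (a : ℕ) (x : ℤ) :
    (S.b S.j₀ : ℚ) ^ (∑ k, σ k) * S.archφ R v B (S.pvΔ v pv c e μ) (a, σ) x =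
      ∑ i ∈ B, ((pv i : ℚ) * (hasseDeriv a (R i)).eval (x : ℚ) * ∏ j, S.α j ^ (v i j * x)) *
        ∏ k, ((dirDelta ℚ (μ k)).eval ((c : ℚ) * ((S.𝔛 (v i) k : ℚ) - (e k : ℚ))) * (S.𝔛 (v i) k : ℚ) ^ σ k) := by
  have hb : (S.b S.j₀ : ℚ) ≠ 0 := S.bj₀_ne_rat
  unfold archφ
  rw [mul_sum]
  refine sum_congr rfl fun i _ => ?_
  rw [S.pvΔ_cast, S.zγpow_eq_prod_mul_inv_pow, prod_mul_distrib]
  simp_rw [S.yΔ_cast]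
  have hbb : (S.b S.j₀ : ℚ) ^ (∑ k, σ k) * ((S.b S.j₀ : ℚ)⁻¹) ^ (∑ k, σ k) = 1 := by
    rw [← mul_pow, mul_inv_cancel₀ hb, one_pow]
  calc (S.b S.j₀ : ℚ) ^ (∑ k, σ k) *
        ((pv i : ℚ) * (∏ k, (dirDelta ℚ (μ k)).eval ((c : ℚ) * ((S.𝔛 (v i) k : ℚ) - (e k : ℚ)))) *
          (hasseDeriv a (R i)).eval (x : ℚ) *
          ((∏ k, (S.𝔛 (v i) k : ℚ) ^ σ k) * ((S.b S.j₀ : ℚ)⁻¹) ^ (∑ k, σ k)) * ∏ j, S.α j ^ (v i j * x))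
      = ((S.b S.j₀ : ℚ) ^ (∑ k, σ k) * ((S.b S.j₀ : ℚ)⁻¹) ^ (∑ k, σ k)) *
          (((pv i : ℚ) * (hasseDeriv a (R i)).eval (x : ℚ) * ∏ j, S.α j ^ (v i j * x)) *
            ((∏ k, (dirDelta ℚ (μ k)).eval ((c : ℚ) * ((S.𝔛 (v i) k : ℚ) - (e k : ℚ)))) *
              ∏ k, (S.𝔛 (v i) k : ℚ) ^ σ k)) := by ring
    _ = _ := by rw [hbb, one_mul]

/-- **The change of basis (print (4.21))**: if, at the integer node `x` and `Y₀`-order `a`, the Δ-VALUES vanish,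
`archφ (pvΔ μ′) (a, 0) x = 0` for all `|μ′| ≤ U` (`c ≠ 0`), then the MIXED values vanish: `archφ (pvΔ μ) (a, σ) x = 0` whenever
`|μ| + |σ| ≤ U` — because `Δ_{μₖ}(c(X − eₖ))·X^{σₖ}` has degree `μₖ + σₖ` and the `∏ₖ Δ_{μ′ₖ}(c(X − eₖ))`, `|μ′| ≤ U`, span all
polynomials of total degree `≤ U`. [cite: Nesterenko2003, §3.5 (3.28)–(3.30), §4.2 (4.21)] -/
theorem archφ_pvΔ_eq_zero_of_delta_vanishing (B : Finset ι) (pv : ι → ℤ) {c : ℤ} (hc : c ≠ 0) (e : Fin S.n → ℤ)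
    (a : ℕ) (x : ℤ) (U : ℕ)
    (hΔ : ∀ μ' : Fin S.n → ℕ, ∑ k, μ' k ≤ U → S.archφ R v B (S.pvΔ v pv c e μ') (a, 0) x = 0)
    (μ σ : Fin S.n → ℕ) (hμσ : ∑ k, (μ k + σ k) ≤ U) :
    S.archφ R v B (S.pvΔ v pv c e μ) (a, σ) x = 0 := by
  classical
  have hb : (S.b S.j₀ : ℚ) ≠ 0 := S.bj₀_ne_rat
  have hcq : ∀ _k : Fin S.n, (c : ℚ) ≠ 0 := fun _ => by exact_mod_cast hc
  -- the weights and the linear-form values of the moment problem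
  set W : ι → ℚ := fun i => (pv i : ℚ) * (hasseDeriv a (R i)).eval (x : ℚ) * ∏ j, S.α j ^ (v i j * x) with hW
  set Xf : ι → Fin S.n → ℚ := fun i k => (S.𝔛 (v i) k : ℚ) with hXf
  -- the Δ-sums vanish
  have hzero : ∀ μ' : Fin S.n → ℕ, ∑ k, μ' k ≤ U →
      ∑ i ∈ B, W i * ∏ k, (dirDelta ℚ (μ' k)).eval ((c : ℚ) * (Xf i k - (e k : ℚ))) = 0 := by
    intro μ' hμ'
    have h := S.bpow_mul_archφ_pvΔ R v B pv c e μ' 0 a x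
    rw [hΔ μ' hμ', mul_zero] at h
    rw [h]
    refine sum_congr rfl fun i _ => ?_
    simp [hW, hXf]
  -- hence the moments vanish, hence the mixed sums vanish
  have hmom := dirMoment_eq_zero_of_dirDelta_sums B W Xf U hcq (fun k => (e k : ℚ)) hzero
  have hmixed := sum_mul_prod_dirDelta_mul_pow_eq_zero B W Xf U hmom μ σ hμσ (fun _ => (c : ℚ)) (fun k => (e k : ℚ))
  -- and the mixed value is `b_{j₀}^{−|σ|}` times the mixed sum
  have h := S.bpow_mul_archφ_pvΔ R v B pv c e μ σ a x
  have hsum0 : ∑ i ∈ B, ((pv i : ℚ) * (hasseDeriv a (R i)).eval (x : ℚ) * ∏ j, S.α j ^ (v i j * x)) *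
      ∏ k, ((dirDelta ℚ (μ k)).eval ((c : ℚ) * ((S.𝔛 (v i) k : ℚ) - (e k : ℚ))) * (S.𝔛 (v i) k : ℚ) ^ σ k) = 0 := by
    simpa [hW, hXf] using hmixed
  rw [hsum0] at h
  rcases mul_eq_zero.mp h with h1 | h1
  · exact absurd h1 (pow_ne_zero _ hb)
  · exact h1

/-! ### Clearing denominators of the values (the Liouville data) -/
/-- In the box `|wⱼ| ≤ Dboxⱼ`: `|wⱼ·x| ≤ Dboxⱼ·|x|`. [folklore] -/
theorem abs_mul_le_box_mul_natAbs {Dbox : Fin S.n → ℕ} {w : Fin S.n → ℤ} (hw : ∀ j, |w j| ≤ (Dbox j : ℤ)) (x : ℤ)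
    (j : Fin S.n) : |w j * x| ≤ ((Dbox j * x.natAbs : ℕ) : ℤ) := by
  have h := mul_le_mul_of_nonneg_right (hw j) (abs_nonneg x)
  push_cast
  simpa [abs_mul] using h

/-- **The Δ-value cleared** (`σ = 0`): for ANY integer coefficient vector `pv′` (in the frame: `pvΔ pv c e μ`), exponents in the box
`|vᵢⱼ| ≤ Dboxⱼ` and a common denominator `den₀` of the `Y₀`-weights `(Hasse_a Rᵢ)(x)`:
`den₀ · monDen(α, Dbox·|x|) · archφ pv′ (a, 0) x ∈ ℤ` — no power of `b_{j₀}`. [cite: Nesterenko2003, §3.5 (p. 72: b(ℓ₀,l,x,m) ∈ ℤ), Lemma 3.11] -/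
theorem exists_int_clear_mul_archφ_zero {Dbox : Fin S.n → ℕ} (B : Finset ι) (pv' : ι → ℤ)
    (hv : ∀ i ∈ B, ∀ j, |v i j| ≤ (Dbox j : ℤ)) (a : ℕ) (x : ℤ) {den₀ : ℕ}
    (hR : ∀ i ∈ B, ∃ z₀ : ℤ, (den₀ : ℚ) * (hasseDeriv a (R i)).eval (x : ℚ) = z₀) :
    ∃ z : ℤ, ((den₀ * MonomialDen.monDen S.α (fun j => Dbox j * x.natAbs) : ℕ) : ℚ) *
      S.archφ R v B pv' ((a, 0) : Tau S.n) x = z := by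
  classical
  have hterm : ∀ i ∈ B, ∃ z : ℤ, ((den₀ * MonomialDen.monDen S.α (fun j => Dbox j * x.natAbs) : ℕ) : ℚ) *
      ((pv' i : ℚ) * (hasseDeriv a (R i)).eval (x : ℚ) * S.zγpow v i 0 * ∏ j, S.α j ^ (v i j * x)) = z := by
    intro i hi
    obtain ⟨z₀, hz₀⟩ := hR i hi
    obtain ⟨z₂, hz₂, -⟩ := MonomialDen.exists_int_monDen_mul_prod_zpow S.α S.α_ne (fun j => Dbox j * x.natAbs)
      (fun j => v i j * x) (S.abs_mul_le_box_mul_natAbs (hv i hi) x)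
    refine ⟨pv' i * z₀ * z₂, ?_⟩
    rw [S.zγpow_zero]
    push_cast
    calc (den₀ : ℚ) * (MonomialDen.monDen S.α (fun j => Dbox j * x.natAbs) : ℚ) *
          ((pv' i : ℚ) * (hasseDeriv a (R i)).eval (x : ℚ) * 1 * ∏ j, S.α j ^ (v i j * x))
        = (pv' i : ℚ) * ((den₀ : ℚ) * (hasseDeriv a (R i)).eval (x : ℚ)) *
          ((MonomialDen.monDen S.α (fun j => Dbox j * x.natAbs) : ℚ) * ∏ j, S.α j ^ (v i j * x)) := by ring
      _ = (pv' i : ℚ) * (z₀ : ℚ) * (z₂ : ℚ) := by rw [hz₀, hz₂]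
  choose! z hz using hterm
  refine ⟨∑ i ∈ B, z i, ?_⟩
  unfold archφ
  rw [mul_sum]
  push_cast
  refine sum_congr rfl fun i hi => ?_
  have h := hz i hi
  push_cast at h
  exact h

/-- **The general value cleared**: with the extra factor `|b_{j₀}|^{|σ|}` for the directional monomial `∏ (𝔛ₖ/b_{j₀})^{σₖ}`:
`den₀ · |b_{j₀}|^{|σ|} · monDen(α, Dbox·|x|) · archφ pv′ (a, σ) x ∈ ℤ`. [cite: Nesterenko2003, §3.5 (p. 72), Lemma 3.11] -/
theorem exists_int_clear_mul_archφ {Dbox : Fin S.n → ℕ} (B : Finset ι) (pv' : ι → ℤ)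
    (hv : ∀ i ∈ B, ∀ j, |v i j| ≤ (Dbox j : ℤ)) (τ : Tau S.n) (x : ℤ) {den₀ : ℕ}
    (hR : ∀ i ∈ B, ∃ z₀ : ℤ, (den₀ : ℚ) * (hasseDeriv τ.1 (R i)).eval (x : ℚ) = z₀) :
    ∃ z : ℤ, ((den₀ * (S.b S.j₀).natAbs ^ (∑ k, τ.2 k) * MonomialDen.monDen S.α (fun j => Dbox j * x.natAbs) : ℕ) : ℚ) *
      S.archφ R v B pv' τ x = z := by
  classical
  have hb : (S.b S.j₀ : ℚ) ≠ 0 := S.bj₀_ne_rat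
  -- `|b_{j₀}|^{|σ|} · zγpow ∈ ℤ`
  have hzγ : ∀ i, ∃ z₁ : ℤ, ((((S.b S.j₀).natAbs ^ (∑ k, τ.2 k) : ℕ)) : ℚ) * S.zγpow v i τ.2 = z₁ := by
    intro i
    refine ⟨(S.b S.j₀).sign ^ (∑ k, τ.2 k) * ∏ k, S.𝔛 (v i) k ^ τ.2 k, ?_⟩
    have hsgn : (((S.b S.j₀).natAbs : ℕ) : ℚ) = ((S.b S.j₀).sign : ℚ) * S.b S.j₀ := by
      rw [Nat.cast_natAbs]; push_cast
      rw [← Int.cast_abs, ← Int.sign_mul_self_eq_abs]; push_cast; ring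
    rw [S.zγpow_eq_prod_mul_inv_pow]
    push_cast
    rw [hsgn, mul_pow]
    have hbb : (S.b S.j₀ : ℚ) ^ (∑ k, τ.2 k) * ((S.b S.j₀ : ℚ)⁻¹) ^ (∑ k, τ.2 k) = 1 := by
      rw [← mul_pow, mul_inv_cancel₀ hb, one_pow]
    calc ((S.b S.j₀).sign : ℚ) ^ (∑ k, τ.2 k) * (S.b S.j₀ : ℚ) ^ (∑ k, τ.2 k) *
          ((∏ k, (S.𝔛 (v i) k : ℚ) ^ τ.2 k) * ((S.b S.j₀ : ℚ)⁻¹) ^ (∑ k, τ.2 k))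
        = ((S.b S.j₀).sign : ℚ) ^ (∑ k, τ.2 k) * (∏ k, (S.𝔛 (v i) k : ℚ) ^ τ.2 k) *
          ((S.b S.j₀ : ℚ) ^ (∑ k, τ.2 k) * ((S.b S.j₀ : ℚ)⁻¹) ^ (∑ k, τ.2 k)) := by ring
      _ = ((S.b S.j₀).sign : ℚ) ^ (∑ k, τ.2 k) * (∏ k, (S.𝔛 (v i) k : ℚ) ^ τ.2 k) := by rw [hbb, mul_one]
  have hterm : ∀ i ∈ B, ∃ z : ℤ,
      ((den₀ * (S.b S.j₀).natAbs ^ (∑ k, τ.2 k) * MonomialDen.monDen S.α (fun j => Dbox j * x.natAbs) : ℕ) : ℚ) *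
        ((pv' i : ℚ) * (hasseDeriv τ.1 (R i)).eval (x : ℚ) * S.zγpow v i τ.2 * ∏ j, S.α j ^ (v i j * x)) = z := by
    intro i hi
    obtain ⟨z₀, hz₀⟩ := hR i hi
    obtain ⟨z₁, hz₁⟩ := hzγ i
    obtain ⟨z₂, hz₂, -⟩ := MonomialDen.exists_int_monDen_mul_prod_zpow S.α S.α_ne (fun j => Dbox j * x.natAbs)
      (fun j => v i j * x) (S.abs_mul_le_box_mul_natAbs (hv i hi) x)
    refine ⟨pv' i * z₀ * z₁ * z₂, ?_⟩
    have e1 := hz₁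
    push_cast at e1 ⊢
    calc (den₀ : ℚ) * ((((S.b S.j₀).natAbs : ℕ) : ℚ) ^ (∑ k, τ.2 k)) *
          (MonomialDen.monDen S.α (fun j => Dbox j * x.natAbs) : ℚ) *
          ((pv' i : ℚ) * (hasseDeriv τ.1 (R i)).eval (x : ℚ) * S.zγpow v i τ.2 * ∏ j, S.α j ^ (v i j * x))
        = (pv' i : ℚ) * ((den₀ : ℚ) * (hasseDeriv τ.1 (R i)).eval (x : ℚ)) *
          (((((S.b S.j₀).natAbs : ℕ) : ℚ) ^ (∑ k, τ.2 k)) * S.zγpow v i τ.2) *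
          ((MonomialDen.monDen S.α (fun j => Dbox j * x.natAbs) : ℚ) * ∏ j, S.α j ^ (v i j * x)) := by ring
      _ = (pv' i : ℚ) * (z₀ : ℚ) * (z₁ : ℚ) * (z₂ : ℚ) := by rw [hz₀, e1, hz₂]
  choose! z hz using hterm
  refine ⟨∑ i ∈ B, z i, ?_⟩
  unfold archφ
  rw [mul_sum]
  push_cast
  refine sum_congr rfl fun i hi => ?_
  have h := hz i hi
  push_cast at h
  exact h

/-- The clearing denominator is `≥ 1` when `den₀ ≥ 1`. [folklore] -/
theorem one_le_clear {Dbox : Fin S.n → ℕ} (x : ℤ) {den₀ : ℕ} (hden₀ : 1 ≤ den₀) (s : ℕ) :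
    1 ≤ den₀ * (S.b S.j₀).natAbs ^ s * MonomialDen.monDen S.α (fun j => Dbox j * x.natAbs) :=
  one_le_mul (one_le_mul hden₀ (Nat.one_le_pow _ _ (Int.natAbs_pos.mpr S.bj₀_ne)))
    (MonomialDen.one_le_monDen S.α S.α_ne _)

/-- **The height cost of the clearing denominator** (Lemma 3.11 in the frame's currency):
`log(den₀ · |b_{j₀}|^s · monDen(α, Dbox·|x|)) ≤ log den₀ + s·log|b_{j₀}| + 2·|x|·Σⱼ Dboxⱼ·h(αⱼ)`.
[cite: Nesterenko2003, §3.5 Lemma 3.11 (3.42)] -/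
theorem log_clear_le {Dbox : Fin S.n → ℕ} (x : ℤ) {den₀ : ℕ} (hden₀ : 1 ≤ den₀) (s : ℕ) :
    Real.log ((den₀ * (S.b S.j₀).natAbs ^ s * MonomialDen.monDen S.α (fun j => Dbox j * x.natAbs) : ℕ) : ℝ) ≤
      Real.log den₀ + s * Real.log |(S.b S.j₀ : ℝ)| + 2 * |(x : ℝ)| * ∑ j, (Dbox j : ℝ) * Height.logHeight₁ (S.α j) := by
  set M : ℕ := MonomialDen.monDen S.α (fun j => Dbox j * x.natAbs) with hM
  have hd0 : (0 : ℝ) < den₀ := by exact_mod_cast (show 0 < den₀ by omega)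
  have hbabs : (0 : ℝ) < |(S.b S.j₀ : ℝ)| := lt_of_lt_of_le one_pos S.one_le_abs_bj₀
  have hm1 : 1 ≤ M := MonomialDen.one_le_monDen S.α S.α_ne _
  have hmpos : (0 : ℝ) < (M : ℝ) := by exact_mod_cast (show 0 < M by omega)
  -- the height cost of `monDen`
  have hmon : Real.log (M : ℝ) ≤ 2 * (|(x : ℝ)| * ∑ j, (Dbox j : ℝ) * Height.logHeight₁ (S.α j)) := by
    have h := MonomialDen.log_monDen_le S.α S.α_ne (fun j => Dbox j * x.natAbs)
    have hsum : ∑ j, (((fun j => Dbox j * x.natAbs) j : ℕ) : ℝ) * Height.logHeight₁ (S.α j) =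
        |(x : ℝ)| * ∑ j, (Dbox j : ℝ) * Height.logHeight₁ (S.α j) := by
      rw [Finset.mul_sum]
      refine sum_congr rfl fun j _ => ?_
      push_cast
      rw [Nat.cast_natAbs, Int.cast_abs]
      ring
    rw [hsum] at h
    exact h
  have hcast : ((den₀ * (S.b S.j₀).natAbs ^ s * M : ℕ) : ℝ) = (den₀ : ℝ) * |(S.b S.j₀ : ℝ)| ^ s * (M : ℝ) := by
    push_cast
    rw [Nat.cast_natAbs, Int.cast_abs]
  rw [hcast, Real.log_mul (by positivity) hmpos.ne', Real.log_mul hd0.ne' (by positivity), Real.log_pow]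
  linarith

/-! ### The Δ-equations as a linear system in the coefficients (the START's matrix) -/
/-- **The coefficient of the unknown `pᵢ` in the Δ-equation at `(x; a, μ)`**:
`qTermΔ c e μ a x i = ∏ₖ multichoose(yₖ(vᵢ), μₖ) · (Hasse_a Rᵢ)(x) · ∏ⱼ αⱼ^{vᵢⱼ x} ∈ ℚ` (print's `a(ℓ₀, l, x, m)` of (3.30) up to the
normalisation of the `Y₀`-weight). [cite: Nesterenko2003, §3.5 (3.29)–(3.30)] -/
def qTermΔ (c : ℤ) (e : Fin S.n → ℤ) (μ : Fin S.n → ℕ) (a : ℕ) (x : ℤ) (i : ι) : ℚ :=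
  ((∏ k, Ring.multichoose (S.yΔ c e (v i) k) (μ k) : ℤ) : ℚ) * (hasseDeriv a (R i)).eval (x : ℚ) * ∏ j, S.α j ^ (v i j * x)

/-- **The Δ-value is linear in the coefficients**: `archφ (pvΔ pv c e μ) (a, 0) x = Σ_{i∈B} pᵢ · qTermΔ c e μ a x i` — the equation of
the START at the node `x` and the multi-index `(a; μ)`. [cite: Nesterenko2003, §3.5 (3.30)] -/
theorem archφ_pvΔ_zero_eq_sum (B : Finset ι) (pv : ι → ℤ) (c : ℤ) (e : Fin S.n → ℤ) (μ : Fin S.n → ℕ) (a : ℕ) (x : ℤ) :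
    S.archφ R v B (S.pvΔ v pv c e μ) ((a, 0) : Tau S.n) x = ∑ i ∈ B, (pv i : ℚ) * S.qTermΔ R v c e μ a x i := by
  unfold archφ qTermΔ pvΔ
  refine sum_congr rfl fun i _ => ?_
  rw [S.zγpow_zero]
  push_cast
  ring

/-- **One matrix entry cleared**: `den₀ · monDen(α, Dbox·|x|) · qTermΔ … i ∈ ℤ` in the box `|vᵢⱼ| ≤ Dboxⱼ`, when `den₀` clears
`(Hasse_a Rᵢ)(x)`. [cite: Nesterenko2003, §3.5 (p. 72)] -/
theorem exists_int_clear_mul_qTermΔ {Dbox : Fin S.n → ℕ} (c : ℤ) (e : Fin S.n → ℤ) (μ : Fin S.n → ℕ) (a : ℕ) (x : ℤ) (i : ι)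
    (hv : ∀ j, |v i j| ≤ (Dbox j : ℤ)) {den₀ : ℕ} {z₀ : ℤ} (hR : (den₀ : ℚ) * (hasseDeriv a (R i)).eval (x : ℚ) = z₀) :
    ∃ z : ℤ, ((den₀ * MonomialDen.monDen S.α (fun j => Dbox j * x.natAbs) : ℕ) : ℚ) * S.qTermΔ R v c e μ a x i = z ∧
      |z| ≤ |∏ k, Ring.multichoose (S.yΔ c e (v i) k) (μ k)| * |z₀| *
        ((MonomialDen.monDen S.α (fun j => Dbox j * x.natAbs) : ℤ)) ^ 2 := by
  obtain ⟨z₂, hz₂, hz₂le⟩ := MonomialDen.exists_int_monDen_mul_prod_zpow S.α S.α_ne (fun j => Dbox j * x.natAbs)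
    (fun j => v i j * x) (S.abs_mul_le_box_mul_natAbs hv x)
  set P : ℤ := ∏ k, Ring.multichoose (S.yΔ c e (v i) k) (μ k) with hP
  set M : ℕ := MonomialDen.monDen S.α (fun j => Dbox j * x.natAbs) with hM
  refine ⟨P * z₀ * z₂, ?_, ?_⟩
  · unfold qTermΔ
    rw [← hP]
    have e2 : (M : ℚ) * ∏ j, S.α j ^ (v i j * x) = (z₂ : ℚ) := by rw [hM]; exact_mod_cast hz₂
    have e3 : ((den₀ * M : ℕ) : ℚ) = (den₀ : ℚ) * (M : ℚ) := by push_cast; ring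
    rw [e3]
    calc (den₀ : ℚ) * (M : ℚ) * ((P : ℚ) * (hasseDeriv a (R i)).eval (x : ℚ) * ∏ j, S.α j ^ (v i j * x))
        = (P : ℚ) * ((den₀ : ℚ) * (hasseDeriv a (R i)).eval (x : ℚ)) * ((M : ℚ) * ∏ j, S.α j ^ (v i j * x)) := by ring
      _ = (P : ℚ) * (z₀ : ℚ) * (z₂ : ℚ) := by rw [hR, e2]
      _ = ((P * z₀ * z₂ : ℤ) : ℚ) := by push_cast; ring
  · rw [abs_mul, abs_mul]
    exact mul_le_mul_of_nonneg_left hz₂le (by positivity)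

/-- **The size of a cleared matrix entry** (real form, normalised): with `|z₀| ≤ M₀`,
`|den₀·monDen·qTermΔ … i| ≤ (Σₖ|yₖ(vᵢ)| + |μ|)^{|μ|}/|μ|! · M₀ · monDen²`. [cite: Nesterenko2003, §3.5 (3.37), (3.43)–(3.44)] -/
theorem abs_clear_mul_qTermΔ_le {Dbox : Fin S.n → ℕ} (c : ℤ) (e : Fin S.n → ℤ) (μ : Fin S.n → ℕ) (a : ℕ) (x : ℤ) (i : ι)
    (hv : ∀ j, |v i j| ≤ (Dbox j : ℤ)) {den₀ : ℕ} {z₀ : ℤ} (hR : (den₀ : ℚ) * (hasseDeriv a (R i)).eval (x : ℚ) = z₀)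
    {M₀ : ℝ} (hM₀ : |(z₀ : ℝ)| ≤ M₀) :
    |((((den₀ * MonomialDen.monDen S.α (fun j => Dbox j * x.natAbs) : ℕ) : ℚ) * S.qTermΔ R v c e μ a x i : ℚ) : ℝ)| ≤
      ((∑ k, |(S.yΔ c e (v i) k : ℝ)| + (∑ k, μ k : ℕ)) ^ (∑ k, μ k) / ((∑ k, μ k)! : ℝ)) * M₀ *
        ((MonomialDen.monDen S.α (fun j => Dbox j * x.natAbs) : ℝ)) ^ 2 := by
  obtain ⟨z, hz, hzle⟩ := S.exists_int_clear_mul_qTermΔ R v c e μ a x i hv hR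
  rw [hz]
  have hzR : |(z : ℝ)| ≤ |((∏ k, Ring.multichoose (S.yΔ c e (v i) k) (μ k) : ℤ) : ℝ)| * |(z₀ : ℝ)| *
      ((MonomialDen.monDen S.α (fun j => Dbox j * x.natAbs) : ℝ)) ^ 2 := by
    have := (Int.cast_le (R := ℝ)).mpr hzle
    push_cast at this
    simpa only [Int.cast_abs, Int.cast_prod] using this
  have hΔ : |((∏ k, Ring.multichoose (S.yΔ c e (v i) k) (μ k) : ℤ) : ℝ)| ≤
      (∑ k, |(S.yΔ c e (v i) k : ℝ)| + (∑ k, μ k : ℕ)) ^ (∑ k, μ k) / ((∑ k, μ k)! : ℝ) := by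
    have h := abs_prod_dirDelta_eval_le (K := ℝ) univ μ (fun k => ((S.yΔ c e (v i) k : ℤ) : ℝ))
    rw [prod_dirDelta_eval_intCast] at h
    simpa using h
  have hM0 : 0 ≤ M₀ := (abs_nonneg _).trans hM₀
  have hmain : |(z : ℝ)| ≤ ((∑ k, |(S.yΔ c e (v i) k : ℝ)| + (∑ k, μ k : ℕ)) ^ (∑ k, μ k) / ((∑ k, μ k)! : ℝ)) * M₀ *
      ((MonomialDen.monDen S.α (fun j => Dbox j * x.natAbs) : ℝ)) ^ 2 :=
    hzR.trans (mul_le_mul_of_nonneg_right (mul_le_mul hΔ hM₀ (abs_nonneg _) (by positivity)) (by positivity))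
  have hcast : ((((z : ℤ) : ℚ)) : ℝ) = (z : ℝ) := by push_cast; rfl
  rw [hcast]
  convert hmain using 3

/-- From the LEVEL INVARIANT in Δ-form to the mixed vanishing the jets need: if `archφ (pvΔ μ′) (a′, 0) x = 0` whenever
`a′ + |μ′| < T` (`c ≠ 0`), then `archφ (pvΔ μ) τ x = 0` whenever `|μ| + |τ| < T`. [cite: Nesterenko2003, §4.2 (4.21)] -/
theorem archφ_pvΔ_eq_zero_of_invariant (B : Finset ι) (pv : ι → ℤ) {c : ℤ} (hc : c ≠ 0) (e : Fin S.n → ℤ) (x : ℤ) (T : ℕ)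
    (hinv : ∀ (a' : ℕ) (μ' : Fin S.n → ℕ), a' + ∑ k, μ' k < T → S.archφ R v B (S.pvΔ v pv c e μ') (a', 0) x = 0)
    (μ : Fin S.n → ℕ) (τ : Tau S.n) (hτ : (∑ k, μ k) + tauNorm τ < T) :
    S.archφ R v B (S.pvΔ v pv c e μ) τ x = 0 := by
  obtain ⟨a, σ⟩ := τ
  unfold tauNorm at hτ
  simp only at hτ
  refine S.archφ_pvΔ_eq_zero_of_delta_vanishing R v B pv hc e a x (T - 1 - a) (fun μ' hμ' => hinv a μ' (by omega)) μ σ ?_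
  rw [sum_add_distrib]
  omega

end ArchG3Setup
end Summit.ABC.StewartYu
end
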